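import Summits.CriticalPhenomena.PercolationContinuityZ3.Theorems.PercNearOneGluingNoHeavyLowerTailKnQuestion8CoefficientwiseCellPAMulti
import Summits.CriticalPhenomena.PercolationContinuityZ3.Theorems.PercNearOneGluingNoHeavyLowerTailKnQuestion8CoefficientwiseOffCluster
import HarnessLib

/-!
# CW-PA ⟸ MEANS-K for MULTIGRAPHS: the first-moment reduction of coefficientwise conditional association by x's red cell

Support file (`--supports stmt-CriticalPhenomena-4575`, closed), prover `prim-lf-2` (gen 32).  No definitions, no named facts, no sorries;
standard axioms.  Memos `prim-lf-2/CW-VDBHK-gen29.md` §8.3 (MEANS-K, "the vdBHK ENGINE"), §8.6–8.7 (design), `prim-lf-2/CW-POINTS-gen32.md` §5.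

The first rung of prim-lf-2's coefficientwise programme (CW-PA; CW-PROGRAMME-gen21) is, for a finite graph `ends : ι → Sym2 V`, terminals
`x, z` and monotone `f, g`, `0 ≤ T := Σ_{s ∈ S} Δf(s)·Δg(s)`, `S = {s : z ∉ C_x(s), z ∉ C_x(sᶜ)}`, `Δf(s) = f(C_x s) − f(C_x sᶜ)`.
By the law of total covariance along the RED CELL of `x` (the red cluster `K = C_x(s)` with the red edges meeting it), `T = V_𝒦 + Q_𝒦`
where `V_𝒦 ≥ 0` is van den Berg–Häggström–Kahn's Theorem 1.3 applied inside each cell (`Coefficientwise.cell_cov_form`, companion file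
`…CoefficientwiseCellPA`) and `Q_𝒦 = Σ_{cells c} (Σ_c Δf)(Σ_c Δg)/|c|` is a FIRST-MOMENT form.  prim-lf-2's conjecture MEANS-K is
`Q_𝒦 ≥ 0` (exact census: 0 negatives over all graphs on ≤ 6 vertices and random graphs on ≤ 8 vertices, memo §8.3); this file is the
kernel-checked reduction
* `Coefficientwise.cell_fibre_le_multi` — the cell inequality in fibre form: on each red cell `c ⊆ S`, `(Σ_c Δf)(Σ_c Δg)/|c| ≤ Σ_c Δf·Δg`
  (`Q_c ≤ T_c`, i.e. `V_c ≥ 0`), for every finite multigraph;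
* `Coefficientwise.cwpa_of_meansK_multi` — `Q_𝒦 ≥ 0 ⟹ T ≥ 0` for every finite multigraph `ends : ι → Sym2 V` (the companion
  `…CoefficientwiseMeansK` has the simple-graph version `cwpa_of_meansK`; this file removes the injectivity hypothesis via `cell_cov_form_multi`);
* `Coefficientwise.cwpa_of_meansKHalf_multi` — the STRONGER first-moment hypothesis MEANS-K-HALF `Σ_c (2Q_c − T_c) ≥ 0` (`Q_𝒦 ≥ V_𝒦`; prim-lf-2 gen 32,
  memo CW-POINTS-gen32 §5: exact census 0 negatives for all up-set pairs on all graphs with ≤ 5 vertices and for point pairs on all graphs with ≤ 7 vertices,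
  min `Q_𝒦/T` = 0.503 at `n = 8`, `m ≤ 10`) also implies CW-PA: `T = Σ_c (2Q_c − T_c) + 2Σ_c (T_c − Q_c)`,
with the cells written as the fibres of `key(s) = (C_x(s), s ∩ I(C_x s))` (`I(W)` = edges meeting `W`) over `S`.  Ingredients: locality of the
red cell (a colouring agreeing with `s₀` on the edges at `C_x(s₀)` has the same red cluster; walk transfer `Coefficientwise.reachable_transfer`),
the parametrisation `u ↦ π ∪ (Bᶜ ∖ u)` of a cell by the blue edges `u` off the cluster, and `cell_cov_form`.
[cite: VandenbergHaggstromKahn2005, Thm. 1.3 (p. 6)]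
-/

noncomputable section

open Finset
open Literature.Probability.Percolation

namespace Summit.CriticalPhenomena.PercolationContinuityZ3.Theorems

namespace Coefficientwise

open scoped Classical

variable {V : Type*}

section MeansK

variable {ι : Type*} [Fintype ι] [DecidableEq ι] [Fintype V] [DecidableEq V]

/-- **The cell inequality along one red cell (fibre form).**  For `s₀ ∈ S`, on the fibre `{s ∈ S : key s = key s₀}` of the red-cell key
(`key(s) = (C_x s, s ∩ I(C_x s))`), `(Σ Δf)(Σ Δg)/#fibre ≤ Σ Δf·Δg` — van den Berg–Häggström–Kahn's Theorem 1.3 in the cell (`cell_cov_form_multi`) after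
parametrising the cell by the blue edges off the red cluster.  Multigraphs allowed.
[cite: VandenbergHaggstromKahn2005, Thm. 1.3 (p. 6)] -/
theorem cell_fibre_le_multi (ends : ι → Sym2 V) (x z : V) (f g : Set V → ℝ)
    (hf : Monotone f) (hg : Monotone g) (s₀ : Finset ι)
    (hs₀S : s₀ ∈ univ.filter (fun s : Finset ι => z ∉ openCluster (ends '' (↑s : Set ι)) x ∧ z ∉ openCluster (ends '' (↑sᶜ : Set ι)) x)) :
    (∑ s ∈ (univ.filter (fun s : Finset ι => z ∉ openCluster (ends '' (↑s : Set ι)) x ∧ z ∉ openCluster (ends '' (↑sᶜ : Set ι)) x)).filter (fun s : Finset ι => (openCluster (ends '' (↑s : Set ι)) x, s ∩ univ.filter (fun i : ι => ∃ v ∈ openCluster (ends '' (↑s : Set ι)) x, v ∈ ends i)) = (openCluster (ends '' (↑s₀ : Set ι)) x, s₀ ∩ univ.filter (fun i : ι => ∃ v ∈ openCluster (ends '' (↑s₀ : Set ι)) x, v ∈ ends i))),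
        (f (openCluster (ends '' (↑s : Set ι)) x) - f (openCluster (ends '' (↑sᶜ : Set ι)) x))) *
      (∑ s ∈ (univ.filter (fun s : Finset ι => z ∉ openCluster (ends '' (↑s : Set ι)) x ∧ z ∉ openCluster (ends '' (↑sᶜ : Set ι)) x)).filter (fun s : Finset ι => (openCluster (ends '' (↑s : Set ι)) x, s ∩ univ.filter (fun i : ι => ∃ v ∈ openCluster (ends '' (↑s : Set ι)) x, v ∈ ends i)) = (openCluster (ends '' (↑s₀ : Set ι)) x, s₀ ∩ univ.filter (fun i : ι => ∃ v ∈ openCluster (ends '' (↑s₀ : Set ι)) x, v ∈ ends i))),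
        (g (openCluster (ends '' (↑s : Set ι)) x) - g (openCluster (ends '' (↑sᶜ : Set ι)) x))) /
      (((univ.filter (fun s : Finset ι => z ∉ openCluster (ends '' (↑s : Set ι)) x ∧ z ∉ openCluster (ends '' (↑sᶜ : Set ι)) x)).filter (fun s : Finset ι => (openCluster (ends '' (↑s : Set ι)) x, s ∩ univ.filter (fun i : ι => ∃ v ∈ openCluster (ends '' (↑s : Set ι)) x, v ∈ ends i)) = (openCluster (ends '' (↑s₀ : Set ι)) x, s₀ ∩ univ.filter (fun i : ι => ∃ v ∈ openCluster (ends '' (↑s₀ : Set ι)) x, v ∈ ends i)))).card : ℝ) ≤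
    ∑ s ∈ (univ.filter (fun s : Finset ι => z ∉ openCluster (ends '' (↑s : Set ι)) x ∧ z ∉ openCluster (ends '' (↑sᶜ : Set ι)) x)).filter (fun s : Finset ι => (openCluster (ends '' (↑s : Set ι)) x, s ∩ univ.filter (fun i : ι => ∃ v ∈ openCluster (ends '' (↑s : Set ι)) x, v ∈ ends i)) = (openCluster (ends '' (↑s₀ : Set ι)) x, s₀ ∩ univ.filter (fun i : ι => ∃ v ∈ openCluster (ends '' (↑s₀ : Set ι)) x, v ∈ ends i))),
        (f (openCluster (ends '' (↑s : Set ι)) x) - f (openCluster (ends '' (↑sᶜ : Set ι)) x)) *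
          (g (openCluster (ends '' (↑s : Set ι)) x) - g (openCluster (ends '' (↑sᶜ : Set ι)) x)) := by
  -- notation
  set K : Finset ι → Set V := fun s => openCluster (ends '' (↑s : Set ι)) x with hK
  set I : Set V → Finset ι := fun W => univ.filter (fun i : ι => ∃ v ∈ W, v ∈ ends i) with hI
  set key : Finset ι → Set V × Finset ι := fun s => (K s, s ∩ I (K s)) with hkey
  set F : Finset ι → ℝ := fun s => f (K s) with hF
  set G : Finset ι → ℝ := fun s => g (K s) with hG
  set S : Finset (Finset ι) := univ.filter (fun s : Finset ι => z ∉ K s ∧ z ∉ K sᶜ) with hS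
  change s₀ ∈ S at hs₀S
  change (∑ s ∈ S.filter (fun s => key s = key s₀), (F s - F sᶜ)) * (∑ s ∈ S.filter (fun s => key s = key s₀), (G s - G sᶜ))
      / ((S.filter (fun s => key s = key s₀)).card : ℝ) ≤ ∑ s ∈ S.filter (fun s => key s = key s₀), (F s - F sᶜ) * (G s - G sᶜ)
  have hKmono : ∀ {s t : Finset ι}, s ⊆ t → K s ⊆ K t := fun hst => openCluster_image_mono ends hst x
  -- tools: closure of `K s` under red adjacency, the edges at a set, locality of the red cell
  have K_closed : ∀ (s : Finset ι) {u w : V}, u ∈ K s → (openGraph (ends '' (↑s : Set ι))).Adj u w → w ∈ K s :=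
    fun s u w hu hadj => SimpleGraph.Reachable.trans hu hadj.reachable
  have mem_I : ∀ (W : Set V) (i : ι) (v : V), v ∈ W → v ∈ ends i → i ∈ I W := by
    intro W i v hv hvi
    simp only [hI, Finset.mem_filter, Finset.mem_univ, true_and]
    exact ⟨v, hv, hvi⟩
  have locality : ∀ s₀ t : Finset ι, t ∩ I (K s₀) = s₀ ∩ I (K s₀) → K t = K s₀ := by
    intro s₀ t ht
    have agree : ∀ i, i ∈ I (K s₀) → (i ∈ t ↔ i ∈ s₀) := by
      intro i hi
      have := congrArg (fun u : Finset ι => i ∈ u) ht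
      simp only [Finset.mem_inter, hi, and_true, eq_iff_iff] at this
      exact this
    have h1 : ∀ u ∈ K s₀, ∀ w, (openGraph (ends '' (↑s₀ : Set ι))).Adj u w →
        (openGraph (ends '' (↑t : Set ι))).Adj u w ∧ w ∈ K s₀ := by
      intro u hu w hadj
      refine ⟨?_, K_closed s₀ hu hadj⟩
      rw [openGraph_image_adj] at hadj ⊢
      obtain ⟨⟨i, his, hi⟩, hne⟩ := hadj
      have hiI : i ∈ I (K s₀) := mem_I _ i u hu (by rw [hi]; exact Sym2.mem_mk_left u w)
      exact ⟨⟨i, (agree i hiI).mpr his, hi⟩, hne⟩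
    have h2 : ∀ u ∈ K s₀, ∀ w, (openGraph (ends '' (↑t : Set ι))).Adj u w →
        (openGraph (ends '' (↑s₀ : Set ι))).Adj u w ∧ w ∈ K s₀ := by
      intro u hu w hadj
      have hadj' : (openGraph (ends '' (↑s₀ : Set ι))).Adj u w := by
        rw [openGraph_image_adj] at hadj ⊢
        obtain ⟨⟨i, hit, hi⟩, hne⟩ := hadj
        have hiI : i ∈ I (K s₀) := mem_I _ i u hu (by rw [hi]; exact Sym2.mem_mk_left u w)
        exact ⟨⟨i, (agree i hiI).mp hit, hi⟩, hne⟩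
      exact ⟨hadj', K_closed s₀ hu hadj'⟩
    ext y
    constructor
    · intro hy
      obtain ⟨p⟩ := hy
      exact ((reachable_transfer (K s₀) h2 p) (mem_openCluster_self _ x)).2
    · intro hy
      obtain ⟨p⟩ := hy
      exact ((reachable_transfer (K s₀) h1 p) (mem_openCluster_self _ x)).1
  have hs₀ : z ∉ K s₀ ∧ z ∉ K s₀ᶜ := (Finset.mem_filter.mp hs₀S).2
  -- frozen data of the cell of `s₀`
  set B : Finset ι := I (K s₀) with hB
  set π : Finset ι := s₀ ∩ B with hπ
  set B₀ : Finset ι := B \ π with hB₀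
  set E₁ : Finset ι := Bᶜ with hE₁
  have hdis : Disjoint B₀ E₁ := by
    rw [hB₀, hE₁, Finset.disjoint_left]
    intro i hi hi'
    exact (Finset.mem_compl.mp hi') (Finset.mem_sdiff.mp hi).1
  set θ : Finset ι → Finset ι := fun u => π ∪ (E₁ \ u) with hθ
  set L : Finset ι → Set V := fun u => openCluster (ends '' (↑(B₀ ∪ u) : Set ι)) x with hL
  set D : Finset (Finset ι) := E₁.powerset.filter (fun u => z ∉ L u) with hD
  -- the cell as the image of `D` under `θ`
  have hθB : ∀ u, θ u ∩ B = π := fun u => by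
    ext i
    simp only [hθ, hE₁, Finset.mem_inter, Finset.mem_union, Finset.mem_sdiff, Finset.mem_compl]
    constructor
    · rintro ⟨h | ⟨hnB, _⟩, hiB⟩
      · exact h
      · exact absurd hiB hnB
    · intro h
      exact ⟨Or.inl h, (Finset.mem_inter.mp (hπ ▸ h)).2⟩
  have hθc : ∀ u, u ⊆ E₁ → (θ u)ᶜ = B₀ ∪ u := fun u hu => by
    ext i
    simp only [hθ, hB₀, hE₁, Finset.mem_compl, Finset.mem_union, Finset.mem_sdiff, not_or, not_and, not_not]
    have huE : i ∈ u → i ∉ B := fun hiu => Finset.mem_compl.mp (by rw [← hE₁]; exact hu hiu)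
    have hπB : i ∈ π → i ∈ B := fun hip => (Finset.mem_inter.mp (hπ ▸ hip)).2
    constructor
    · rintro ⟨hnπ, himp⟩
      by_cases hiB : i ∈ B
      · exact Or.inl ⟨hiB, hnπ⟩
      · exact Or.inr (himp hiB)
    · rintro (⟨hiB, hnπ⟩ | hiu)
      · exact ⟨hnπ, fun h => absurd hiB h⟩
      · exact ⟨fun hip => huE hiu (hπB hip), fun _ => hiu⟩
  have hKθ : ∀ u, K (θ u) = K s₀ := fun u => locality s₀ (θ u) (by rw [hθB u])
  have hKθc : ∀ u, u ⊆ E₁ → K (θ u)ᶜ = L u := fun u hu => by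
    simp only [hK, hL, hθc u hu]
  have hθinj : Set.InjOn θ ↑(E₁.powerset) := by
    intro u₁ hu₁ u₂ hu₂ h
    have hu₁' : u₁ ⊆ E₁ := Finset.mem_powerset.1 hu₁
    have hu₂' : u₂ ⊆ E₁ := Finset.mem_powerset.1 hu₂
    have := congrArg (fun t : Finset ι => tᶜ) h
    simp only [hθc u₁ hu₁', hθc u₂ hu₂'] at this
    ext i
    constructor
    · intro hi
      have : i ∈ B₀ ∪ u₂ := by rw [← this]; exact Finset.mem_union_right _ hi
      rcases Finset.mem_union.mp this with hiB₀ | hi2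
      · exact absurd (hu₁' hi) (Finset.disjoint_left.mp hdis hiB₀)
      · exact hi2
    · intro hi
      have : i ∈ B₀ ∪ u₁ := by rw [this]; exact Finset.mem_union_right _ hi
      rcases Finset.mem_union.mp this with hiB₀ | hi1
      · exact absurd (hu₂' hi) (Finset.disjoint_left.mp hdis hiB₀)
      · exact hi1
  have hDsub : (D : Set (Finset ι)) ⊆ ↑(E₁.powerset) := fun u hu =>
    (Finset.mem_filter.mp hu).1
  have fiber_eq : S.filter (fun t => key t = key s₀) = D.image θ := by
    ext t
    simp only [Finset.mem_filter, Finset.mem_image]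
    constructor
    · rintro ⟨htS, hkt⟩
      have h1 : K t = K s₀ := (Prod.ext_iff.mp hkt).1
      have h2 : t ∩ I (K t) = s₀ ∩ I (K s₀) := (Prod.ext_iff.mp hkt).2
      rw [h1] at h2
      -- `t = θ (tᶜ ∩ E₁)`
      set u : Finset ι := tᶜ ∩ E₁ with hu
      have huE : u ⊆ E₁ := Finset.inter_subset_right
      have htB : t ∩ B = π := by simp only [hB, hπ]; exact h2
      have htu : θ u = t := by
        ext i
        simp only [hθ]
        constructor
        · intro hi
          rcases Finset.mem_union.mp hi with hip | hi2
          · have : i ∈ t ∩ B := by rw [htB]; exact hip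
            exact (Finset.mem_inter.mp this).1
          · have hiE : i ∈ E₁ := (Finset.mem_sdiff.mp hi2).1
            have hnu : i ∉ u := (Finset.mem_sdiff.mp hi2).2
            by_contra hit
            exact hnu (Finset.mem_inter.mpr ⟨Finset.mem_compl.mpr hit, hiE⟩)
        · intro hit
          by_cases hiB : i ∈ B
          · exact Finset.mem_union_left _ (by rw [← htB]; exact Finset.mem_inter.mpr ⟨hit, hiB⟩)
          · refine Finset.mem_union_right _ (Finset.mem_sdiff.mpr ⟨?_, ?_⟩)
            · rw [hE₁]; exact Finset.mem_compl.mpr hiB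
            · intro hiu
              exact (Finset.mem_compl.mp (Finset.mem_inter.mp hiu).1) hit
      refine ⟨u, ?_, htu⟩
      rw [hD, Finset.mem_filter, Finset.mem_powerset]
      refine ⟨huE, ?_⟩
      rw [← hKθc u huE, htu]
      exact ((Finset.mem_filter.mp htS).2).2
    · rintro ⟨u, huD, rfl⟩
      have huE : u ⊆ E₁ := Finset.mem_powerset.mp (Finset.mem_filter.mp huD).1
      have hzL : z ∉ L u := (Finset.mem_filter.mp huD).2
      refine ⟨?_, ?_⟩
      · rw [hS, Finset.mem_filter]
        refine ⟨Finset.mem_univ _, ?_, ?_⟩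
        · rw [hKθ u]; exact hs₀.1
        · rw [hKθc u huE]; exact hzL
      · change (K (θ u), θ u ∩ I (K (θ u))) = (K s₀, s₀ ∩ I (K s₀))
        rw [hKθ u]
        exact Prod.ext rfl (hθB u)
  rw [fiber_eq]
  have hθinjD : Set.InjOn θ ↑D := hθinj.mono hDsub
  rw [Finset.card_image_of_injOn hθinjD, Finset.sum_image hθinjD, Finset.sum_image hθinjD, Finset.sum_image hθinjD]
  -- rewrite the summands on `D`
  have hsum : ∀ (φ : ℝ → ℝ → ℝ), ∑ u ∈ D, φ (F (θ u) - F (θ u)ᶜ) (G (θ u) - G (θ u)ᶜ)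
      = ∑ u ∈ D, φ (f (K s₀) - f (L u)) (g (K s₀) - g (L u)) := by
    intro φ
    refine Finset.sum_congr rfl fun u hu => ?_
    have huE : u ⊆ E₁ := Finset.mem_powerset.mp (Finset.mem_filter.mp hu).1
    simp only [hF, hG, hKθ u, hKθc u huE]
  rw [hsum (fun a _ => a), hsum (fun _ b => b), hsum (fun a b => a * b)]
  -- CELL-PA in covariance form, and the division
  have cov := cell_cov_form_multi ends x z B₀ E₁ hdis f g hf hg (f (K s₀)) (g (K s₀))
  change (∑ u ∈ D, (f (K s₀) - f (L u))) * (∑ u ∈ D, (g (K s₀) - g (L u)))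
      ≤ (D.card : ℝ) * ∑ u ∈ D, (f (K s₀) - f (L u)) * (g (K s₀) - g (L u)) at cov
  by_cases hD0 : D.card = 0
  · have hDe : D = ∅ := Finset.card_eq_zero.mp hD0
    simp [hDe]
  · have hNpos : (0 : ℝ) < (D.card : ℝ) := by exact_mod_cast Nat.pos_of_ne_zero hD0
    rw [div_le_iff₀ hNpos]
    linarith [cov]

/-- **CW-PA ⟸ MEANS-K for multigraphs (prim-lf-2's first-moment reduction by x's red cell, kernel form).**  Multigraph `ends : ι → Sym2 V`,
terminals `x, z`, monotone `f, g`; `S = {s : z ∉ C_x(s), z ∉ C_x(sᶜ)}` (no monochromatic `x–z` path), `Δf(s) = f(C_x s) − f(C_x sᶜ)`.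
The RED CELL of `s` is `key(s) = (C_x(s), s ∩ I(C_x s))` (`I(W)` = edges meeting `W`); the cells partition `S`.  MEANS-K
(memo CW-VDBHK-gen29 §8.3, conjecture; exact census 0 negatives through all graphs on 6 vertices, random n ≤ 8) is the hypothesis
  `0 ≤ Σ_{cells c} (Σ_{s∈c} Δf(s))·(Σ_{s∈c} Δg(s)) / |c|`   (`= Q_K`, a first-moment form: only the cell means of `Δf, Δg` enter),
and the conclusion is the first rung CW-PA, `0 ≤ Σ_{s∈S} Δf(s)·Δg(s)`.  Proof: split the sum along the cells; on the cell of `s₀`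
(`B = I(C_x s₀)`, `π = s₀ ∩ B`) the colourings are `π ∪ (Bᶜ ∖ u)` with blue set `(B ∖ π) ∪ u`, `u ⊆ Bᶜ`, the red cluster is frozen
(`locality`) and the blue one is `L(u) = C_x((B∖π) ∪ u)`, so the cell's contribution is `Σ_{u∈D} (f(K)−f(L u))(g(K)−g(L u))`, which
`cell_cov_form_multi` (vdBHK Thm 1.3 in the cell, multigraph bridge) bounds below by `(Σ Δf)(Σ Δg)/|c|`.
[cite: VandenbergHaggstromKahn2005, Thm. 1.3 (p. 6)] -/
theorem cwpa_of_meansK_multi (ends : ι → Sym2 V) (x z : V) (f g : Set V → ℝ)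
    (hf : Monotone f) (hg : Monotone g)
    (hMK : 0 ≤ ∑ k ∈ (univ.filter (fun s : Finset ι => z ∉ openCluster (ends '' (↑s : Set ι)) x ∧ z ∉ openCluster (ends '' (↑sᶜ : Set ι)) x)).image (fun s : Finset ι => (openCluster (ends '' (↑s : Set ι)) x, s ∩ univ.filter (fun i : ι => ∃ v ∈ openCluster (ends '' (↑s : Set ι)) x, v ∈ ends i))),
        (∑ s ∈ (univ.filter (fun s : Finset ι => z ∉ openCluster (ends '' (↑s : Set ι)) x ∧ z ∉ openCluster (ends '' (↑sᶜ : Set ι)) x)).filter (fun s : Finset ι => (openCluster (ends '' (↑s : Set ι)) x, s ∩ univ.filter (fun i : ι => ∃ v ∈ openCluster (ends '' (↑s : Set ι)) x, v ∈ ends i)) = k),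
            (f (openCluster (ends '' (↑s : Set ι)) x) - f (openCluster (ends '' (↑sᶜ : Set ι)) x))) *
          (∑ s ∈ (univ.filter (fun s : Finset ι => z ∉ openCluster (ends '' (↑s : Set ι)) x ∧ z ∉ openCluster (ends '' (↑sᶜ : Set ι)) x)).filter (fun s : Finset ι => (openCluster (ends '' (↑s : Set ι)) x, s ∩ univ.filter (fun i : ι => ∃ v ∈ openCluster (ends '' (↑s : Set ι)) x, v ∈ ends i)) = k),
            (g (openCluster (ends '' (↑s : Set ι)) x) - g (openCluster (ends '' (↑sᶜ : Set ι)) x))) /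
          (((univ.filter (fun s : Finset ι => z ∉ openCluster (ends '' (↑s : Set ι)) x ∧ z ∉ openCluster (ends '' (↑sᶜ : Set ι)) x)).filter (fun s : Finset ι => (openCluster (ends '' (↑s : Set ι)) x, s ∩ univ.filter (fun i : ι => ∃ v ∈ openCluster (ends '' (↑s : Set ι)) x, v ∈ ends i)) = k)).card : ℝ)) :
    0 ≤ ∑ s ∈ univ.filter (fun s : Finset ι => z ∉ openCluster (ends '' (↑s : Set ι)) x ∧ z ∉ openCluster (ends '' (↑sᶜ : Set ι)) x),
        (f (openCluster (ends '' (↑s : Set ι)) x) - f (openCluster (ends '' (↑sᶜ : Set ι)) x)) *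
          (g (openCluster (ends '' (↑s : Set ι)) x) - g (openCluster (ends '' (↑sᶜ : Set ι)) x)) := by
  rw [← Finset.sum_fiberwise_of_maps_to (g := fun s : Finset ι => (openCluster (ends '' (↑s : Set ι)) x, s ∩ univ.filter (fun i : ι => ∃ v ∈ openCluster (ends '' (↑s : Set ι)) x, v ∈ ends i)))
    (fun s hs => Finset.mem_image_of_mem _ hs)]
  refine le_trans hMK (Finset.sum_le_sum fun k hk => ?_)
  obtain ⟨s₀, hs₀S, rfl⟩ := Finset.mem_image.mp hk
  exact cell_fibre_le_multi ends x z f g hf hg s₀ hs₀S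

/-- **CW-PA ⟸ MEANS-K-HALF (multigraphs).**  With the red cells as in `cwpa_of_meansK_multi` and, per cell `c`, `T_c = Σ_c Δf·Δg`,
`Q_c = (Σ_c Δf)(Σ_c Δg)/|c|`: the hypothesis MEANS-K-HALF `0 ≤ Σ_c (2·Q_c − T_c)` (i.e. `Q_𝒦 ≥ ½·T`, equivalently `Q_𝒦 ≥ V_𝒦`, equivalently
`Σ_c |c|·b_f(c)·Y_g(c) ≤ 0` with `b_f(c)` the cell average of `f(C_x sᶜ)` and `Y_g(c) = g(K_c) − b_g(c)`; prim-lf-2 gen 32: exact for all up-set pairs on all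
graphs with ≤ 5 vertices and for point pairs on all graphs with ≤ 7 vertices) implies CW-PA: `T = Σ_c T_c = Σ_c (2Q_c − T_c) + 2·Σ_c (T_c − Q_c) ≥ 0` by
`cell_fibre_le_multi` (`Q_c ≤ T_c`, vdBHK Thm 1.3 in the cell). [cite: VandenbergHaggstromKahn2005, Thm. 1.3 (p. 6)] -/
theorem cwpa_of_meansKHalf_multi (ends : ι → Sym2 V) (x z : V) (f g : Set V → ℝ)
    (hf : Monotone f) (hg : Monotone g)
    (hH : 0 ≤ ∑ k ∈ (univ.filter (fun s : Finset ι => z ∉ openCluster (ends '' (↑s : Set ι)) x ∧ z ∉ openCluster (ends '' (↑sᶜ : Set ι)) x)).image (fun s : Finset ι => (openCluster (ends '' (↑s : Set ι)) x, s ∩ univ.filter (fun i : ι => ∃ v ∈ openCluster (ends '' (↑s : Set ι)) x, v ∈ ends i))),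
        (2 * ((∑ s ∈ (univ.filter (fun s : Finset ι => z ∉ openCluster (ends '' (↑s : Set ι)) x ∧ z ∉ openCluster (ends '' (↑sᶜ : Set ι)) x)).filter (fun s : Finset ι => (openCluster (ends '' (↑s : Set ι)) x, s ∩ univ.filter (fun i : ι => ∃ v ∈ openCluster (ends '' (↑s : Set ι)) x, v ∈ ends i)) = k),
            (f (openCluster (ends '' (↑s : Set ι)) x) - f (openCluster (ends '' (↑sᶜ : Set ι)) x))) *
          (∑ s ∈ (univ.filter (fun s : Finset ι => z ∉ openCluster (ends '' (↑s : Set ι)) x ∧ z ∉ openCluster (ends '' (↑sᶜ : Set ι)) x)).filter (fun s : Finset ι => (openCluster (ends '' (↑s : Set ι)) x, s ∩ univ.filter (fun i : ι => ∃ v ∈ openCluster (ends '' (↑s : Set ι)) x, v ∈ ends i)) = k),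
            (g (openCluster (ends '' (↑s : Set ι)) x) - g (openCluster (ends '' (↑sᶜ : Set ι)) x))) /
          (((univ.filter (fun s : Finset ι => z ∉ openCluster (ends '' (↑s : Set ι)) x ∧ z ∉ openCluster (ends '' (↑sᶜ : Set ι)) x)).filter (fun s : Finset ι => (openCluster (ends '' (↑s : Set ι)) x, s ∩ univ.filter (fun i : ι => ∃ v ∈ openCluster (ends '' (↑s : Set ι)) x, v ∈ ends i)) = k)).card : ℝ))
         - ∑ s ∈ (univ.filter (fun s : Finset ι => z ∉ openCluster (ends '' (↑s : Set ι)) x ∧ z ∉ openCluster (ends '' (↑sᶜ : Set ι)) x)).filter (fun s : Finset ι => (openCluster (ends '' (↑s : Set ι)) x, s ∩ univ.filter (fun i : ι => ∃ v ∈ openCluster (ends '' (↑s : Set ι)) x, v ∈ ends i)) = k),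
            (f (openCluster (ends '' (↑s : Set ι)) x) - f (openCluster (ends '' (↑sᶜ : Set ι)) x)) *
              (g (openCluster (ends '' (↑s : Set ι)) x) - g (openCluster (ends '' (↑sᶜ : Set ι)) x)))) :
    0 ≤ ∑ s ∈ univ.filter (fun s : Finset ι => z ∉ openCluster (ends '' (↑s : Set ι)) x ∧ z ∉ openCluster (ends '' (↑sᶜ : Set ι)) x),
        (f (openCluster (ends '' (↑s : Set ι)) x) - f (openCluster (ends '' (↑sᶜ : Set ι)) x)) *
          (g (openCluster (ends '' (↑s : Set ι)) x) - g (openCluster (ends '' (↑sᶜ : Set ι)) x)) := by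
  rw [← Finset.sum_fiberwise_of_maps_to (g := fun s : Finset ι => (openCluster (ends '' (↑s : Set ι)) x, s ∩ univ.filter (fun i : ι => ∃ v ∈ openCluster (ends '' (↑s : Set ι)) x, v ∈ ends i)))
    (fun s hs => Finset.mem_image_of_mem _ hs)]
  refine le_trans hH (Finset.sum_le_sum fun k hk => ?_)
  obtain ⟨s₀, hs₀S, rfl⟩ := Finset.mem_image.mp hk
  have h := cell_fibre_le_multi ends x z f g hf hg s₀ hs₀S
  linarith [h]

end MeansK

end Coefficientwise

end Summit.CriticalPhenomena.PercolationContinuityZ3.Theorems
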